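import Summits.QuantumFields.YangMills.Theorems.UnitScaleTiltProp7AxialLemma1
import Summits.QuantumFields.YangMills.Theorems.UnitScaleTiltProp7LinearisedChartOneStep
import HarnessLib

/-!
# Route `UnitScaleTilt`, crux K1 child «MinimiserStabilityRegPr» (stmt-QuantumFields-19200), registered stub `stub_prop7From14` (skeleton birth_v7
# cc37a178…; leaf V3 «Prop 7 from a background (14)») — [Balaban1985RegularSpaces] LEMMA 1 AT THE CARRIER FOR PRINT'S BACKGROUND (14)
# `U₀ ∈ 𝔘_k(a)`, `|Ū₀ − V| < b` (`T3SectALandauChart.Sat14T3 a b V U₀`): the comb-axial (4)-representative of `W ∈ 𝔘_k(ε₀) ∩ 𝔅_k(V)` relative to `U₀` satisfies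
# `‖W_bU₀,b* − 1‖ ≤ 113(ε₀ + a) + b` on every bond (`L ≥ 7`, `50(500L + 7L²)·e ≤ 1` for `e = ε₀, a`)

Cell `ym3-torus` ∕ fleet seat `ym-ust-19200-p1` (gen 7; HUMAN RULING D-0037, YM ladder rung R3).  The last bookkeeping step of this seat's Lemma-1 package: the
middle term `β` of `…AxialGaugeFace.dist1_mul_inv_le_face_T3` ∕ `…AxialLemma1.norm_pertVar_le_of_combAxial_T3` (the distance of the two `(K−n)`-fold
(0.4)-averages) IS print's `α₁ = C₁ε₁` of (14) «|Ū₀ʲ − V| < C₁ε₁»: for `W` in the fibre of `V` the `(K−n)`-fold average of `W` is `V` read through the level shift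
(`T3TiltDescent.descendTo` = `fieldShift ∘ iter`), that of `U₀` is `Ū₀`, and `dist1(V(c)Ū₀(c)⁻¹) = ‖Ū₀(c) − V(c)‖` (unitary invariance of the L²-operator norm,
`Prop7AvgLinearisation.norm_coe_sub_coe_eq_norm_pertVar`).

WHAT IS PROVED (sorry-free, no definition): `dist1_iter_le_of_closeAvg` (`W ∈ 𝔅_k(V)`, `CloseAvg b V U₀` ⟹ the two averages are within `b` in `dist1` at every
coarse bond), **`norm_pertVar_le_of_combAxial_of_sat14_T3`** (the displayed bound), **`exists_axial18_sup_sat14`** (existence of the (4)-representative with the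
bounds: all bonds `≤ 113(ε₀ + a) + b`, interior bonds `≤ 3(ε₀ + a)L^{−(K−n)}`).  HONEST SCOPE as in `…AxialLemma1`.

References: T. Bałaban, CMP 102 (1985) 277–309 [Balaban1985Variational] ((14) p.280, (18) p.280); CMP 99 (1985) 75–102 [Balaban1985RegularSpaces] (Lemma 1 (1.24)–(1.25) p.79).
-/

noncomputable section

namespace Summit.QuantumFields.YangMills.Theorems.Prop7AxialLemma14

open scoped Matrix.Norms.L2Operator
open Literature.MathematicalPhysics.QuantumFieldTheory.Balaban1983to89
open T4Continuum BlockAveraging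
open B10Eq27TorusAxialLog (axialT)
open B5Eq118OneStroke (iterBlockOf)
open B15DeterminingSets (embIter)
open Literature.MathematicalPhysics.QuantumFieldTheory.Balaban1983to89.T3ContinuumYM3Torus
open Literature.MathematicalPhysics.QuantumFieldTheory.Balaban1983to89.T3LevelShift
open Literature.MathematicalPhysics.QuantumFieldTheory.Balaban1983to89.T3UnitLawDensityEML (ℰp)
open Literature.MathematicalPhysics.QuantumFieldTheory.Balaban1983to89.T3TiltDescent (descendTo)
open Literature.MathematicalPhysics.QuantumFieldTheory.Balaban1983to89.T3ConstrainedMinimiser (fibre)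
open Literature.MathematicalPhysics.QuantumFieldTheory.Balaban1983to89.T3PrintedRegularMinimiser (RegPr regFibrePr mem_regFibrePr_iff)
open Literature.MathematicalPhysics.QuantumFieldTheory.Balaban1983to89.T3PrintedRegularOrbits (descTransf)
open Literature.MathematicalPhysics.QuantumFieldTheory.Balaban1983to89.T3SectALandauChart (CloseAvg Sat14T3 pos_of_regPr)
open BlockAveragingEMLLinearisedBackground (pertVar)
open Summit.QuantumFields.YangMills.Theorems.Prop7AvgLinearisation (norm_coe_sub_coe_eq_norm_pertVar)
open Summit.QuantumFields.YangMills.Theorems.Prop7AxialLemma1 (norm_pertVar_le_of_combAxial_T3)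
open Summit.QuantumFields.YangMills.Theorems.Prop7AxialSpace18 (exists_axial18)

variable (F : T3Family) {n K : ℕ} (h : n ≤ K)

/-- **THE MIDDLE TERM IS PRINT'S (14)**: if `W ∈ 𝔅_k(V)` and `|Ū₀ − V| < b` bondwise (`CloseAvg`), then at every coarse bond the `(K−n)`-fold (0.4)-averages of `W`
and `U₀` are within `b` in `dist1`. [cite: Balaban1985Variational, (14) p.280, (3) p.278] -/
theorem dist1_iter_le_of_closeAvg {b : ℝ} {V : GaugeField (F.P n) 0 (Matrix.specialUnitaryGroup (Fin 2) ℂ)}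
    {W U₀ : GaugeField (F.P K) 0 (Matrix.specialUnitaryGroup (Fin 2) ℂ)} (hW : W ∈ fibre F ℰp n K h V) (hU₀ : CloseAvg F n K h b V U₀)
    (c : PBond (F.P K) (K - n)) :
    dist1 (Averaging.iter (fun j => blockAvg (P := F.P K) (j := j) (ExpMeanLog.expMeanLogSU (n := Fin 2))) (K - n) W c *
      (Averaging.iter (fun j => blockAvg (P := F.P K) (j := j) (ExpMeanLog.expMeanLogSU (n := Fin 2))) (K - n) U₀ c)⁻¹) ≤ b := by
  set hs := F.sitesPerDir_eq (m := F.m) (K := n) (j := 0) (m' := F.m) (K' := K) (j' := K - n) (by omega) with hhs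
  -- both averages read through the level shift
  have hWi : Averaging.iter (fun j => blockAvg (P := F.P K) (j := j) (ExpMeanLog.expMeanLogSU (n := Fin 2))) (K - n) W = fieldShift hs.symm V := by
    have h1 : descendTo F ℰp n K h W = V := hW
    unfold descendTo at h1
    have h2 := congrArg (fieldShift (G := Matrix.specialUnitaryGroup (Fin 2) ℂ) hs.symm) h1
    rwa [fieldShift_fieldShift_symm] at h2
  have hUi : Averaging.iter (fun j => blockAvg (P := F.P K) (j := j) (ExpMeanLog.expMeanLogSU (n := Fin 2))) (K - n) U₀ =
      fieldShift hs.symm (descendTo F ℰp n K h U₀) := by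
    unfold descendTo
    rw [fieldShift_fieldShift_symm]
  rw [hWi, hUi, fieldShift_apply, fieldShift_apply]
  set c' := bondShift hs.symm c
  -- `dist1(V(c′)·Ū₀(c′)⁻¹) = ‖pertVar Ū₀ V c′‖ = ‖V(c′) − Ū₀(c′)‖ = ‖Ū₀(c′) − V(c′)‖ < b`
  have e1 : dist1 (V c' * (descendTo F ℰp n K h U₀ c')⁻¹) = ‖pertVar (descendTo F ℰp n K h U₀) V c'‖ := rfl
  rw [e1, ← norm_coe_sub_coe_eq_norm_pertVar, norm_sub_rev]
  exact (hU₀ c').le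

/-- **[Balaban1985RegularSpaces] LEMMA 1 AT THE CARRIER FOR A BACKGROUND OF PRINT'S KIND (14)**: `U₀ ∈ 𝔘_k(a)` with `|Ū₀ − V| < b`, `W ∈ 𝔘_k(ε₀) ∩ 𝔅_k(V)`
comb-axial relative to `U₀` (`L ≥ 7`, `50(500L + 7L²)·e ≤ 1` for `e = ε₀, a`) ⟹ `‖pertVar U₀ W b‖ ≤ 113(ε₀ + a) + b` on every bond.
[cite: Balaban1985RegularSpaces, Lemma 1 (1.25) p.79; Balaban1985Variational, (14) p.280] -/
theorem norm_pertVar_le_of_combAxial_of_sat14_T3 (hL : 7 ≤ F.L) {ε₀ a b : ℝ}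
    (hε : 50 * (500 * (F.L : ℝ) + 7 * (F.L : ℝ) ^ 2) * ε₀ ≤ 1) (ha : 50 * (500 * (F.L : ℝ) + 7 * (F.L : ℝ) ^ 2) * a ≤ 1)
    {V : GaugeField (F.P n) 0 (Matrix.specialUnitaryGroup (Fin 2) ℂ)} (W U₀ : GaugeField (F.P K) 0 (Matrix.specialUnitaryGroup (Fin 2) ℂ))
    (hW : W ∈ regFibrePr F n K h ε₀ V) (hU₀ : Sat14T3 F n K h a b V U₀)
    (hax : ∀ x : Site (F.P K) 0, axialT W (embIter (K - n) (iterBlockOf (K - n) x)) x = axialT U₀ (embIter (K - n) (iterBlockOf (K - n) x)) x)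
    (bd : PBond (F.P K) 0) : ‖pertVar U₀ W bd‖ ≤ 113 * (ε₀ + a) + b := by
  -- `0 ≤ b`: the closeness holds at some coarse bond
  let μ : Fin (F.P n).d := ⟨0, by simp⟩
  have hb : 0 ≤ b := (norm_nonneg _).trans (hU₀.2 ⟨fun _ => 0, μ⟩).le
  exact norm_pertVar_le_of_combAxial_T3 F h hL hb hε ha W U₀ hW hU₀.1 hax
    (dist1_iter_le_of_closeAvg F h ((mem_regFibrePr_iff F).mp hW).1 hU₀.2) bd

/-- **THE AXIAL SPACE (18) OVER A BACKGROUND OF KIND (14), WITH ITS SUP-NORM DESCRIPTION**: for `U₀` with `Sat14T3 a b V U₀` and every `W ∈ 𝔘_k(ε₀) ∩ 𝔅_k(V)`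
there is `v` in the group (4) with `W^v` in the same regular fibre, comb-axial relative to `U₀`, `‖pertVar U₀ W^v b‖ ≤ 113(ε₀ + a) + b` on every bond and
`≤ 3(ε₀ + a)L^{−(K−n)}` on interior bonds (`L ≥ 7`, both radii small). [cite: Balaban1985Variational, (14) and (18) p.280; Balaban1985RegularSpaces, Lemma 1 (1.25) p.79] -/
theorem exists_axial18_sup_sat14 (hL : 7 ≤ F.L) {ε₀ a b : ℝ}
    (hε : 50 * (500 * (F.L : ℝ) + 7 * (F.L : ℝ) ^ 2) * ε₀ ≤ 1) (ha : 50 * (500 * (F.L : ℝ) + 7 * (F.L : ℝ) ^ 2) * a ≤ 1)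
    {V : GaugeField (F.P n) 0 (Matrix.specialUnitaryGroup (Fin 2) ℂ)} (U₀ W : GaugeField (F.P K) 0 (Matrix.specialUnitaryGroup (Fin 2) ℂ))
    (hU₀ : Sat14T3 F n K h a b V U₀) (hW : W ∈ regFibrePr F n K h ε₀ V) :
    ∃ v : GaugeTransf (F.P K) 0 (Matrix.specialUnitaryGroup (Fin 2) ℂ),
      descTransf F n K h v = (fun _ => 1) ∧
      GaugeField.gaugeAct v W ∈ regFibrePr F n K h ε₀ V ∧
      (∀ x : Site (F.P K) 0, axialT (GaugeField.gaugeAct v W) (embIter (K - n) (iterBlockOf (K - n) x)) x =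
        axialT U₀ (embIter (K - n) (iterBlockOf (K - n) x)) x) ∧
      (∀ bd : PBond (F.P K) 0, ‖pertVar U₀ (GaugeField.gaugeAct v W) bd‖ ≤ 113 * (ε₀ + a) + b) ∧
      ∀ (x : Site (F.P K) 0) (μ : Fin (F.P K).d), iterBlockOf (K - n) (x.shift μ) = iterBlockOf (K - n) x →
        ‖pertVar U₀ (GaugeField.gaugeAct v W) ⟨x, μ⟩‖ ≤ 3 * (ε₀ + a) * (((F.L : ℝ))⁻¹) ^ (K - n) := by
  have ha0 : 0 < a := pos_of_regPr F hU₀.1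
  obtain ⟨v, hv, hmem, hax, -, -, hint⟩ := exists_axial18 F h ha0.le U₀ W hU₀.1 hW
  exact ⟨v, hv, hmem, hax, fun bd => norm_pertVar_le_of_combAxial_of_sat14_T3 F h hL hε ha _ U₀ hmem hU₀ hax bd, hint⟩

end Summit.QuantumFields.YangMills.Theorems.Prop7AxialLemma14

end
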